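import Literature.NumberTheory.DiophantineGeometry.KoizumiOfRoadWHeads
import Literature.NumberTheory.DiophantineGeometry.SmoothProperModelBirationalGroupLaw
import HarnessLib

/-!
# Koizumi's good-reduction theorem modulo the Weil group chunk alone

Road W of the `hodgecm-mathlib` cell (Néron capital banked next to the closed crux H21 ★ p633027):
`koizumi_reductionAt_of_roadW (hW0) (hW1)` ★ p642862 is Koizumi's theorem at every finite place modulo the
two heads (W0) = «the group law of the generic fibre is an `R`-birational group law on a smooth proper model»
and (W1) = «Weil's group-chunk theorem over a strictly henselian complete DVR» (v6 text).  This file DISCHARGES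
(W0) by the theorem `SmoothProperModelBirationalGroupLaw.exists_birationalGroupLaw_of_smooth_proper`
(B-p11/B-p18 table: core ★ `core_fst`, leaves S7 ★ p643097, hpin ★ p643837, L4c′ ★ p641619, ISO-PACK ★ p640036 …),
whose only extra binder `[IsOpenImmersion (specGenericPoint R K)]` holds for every DVR
(`isOpenImmersion_specGenericPoint`).  What remains is EXACTLY ONE head, `hW1`.

HC_CM is proved only modulo the 7 printed citations until rung 0 closes; road W is banked capital (0 floor distance).
-/

set_option autoImplicit false

noncomputable section

open CategoryTheory CategoryTheory.Limits AlgebraicGeometry MonoidalCategory CartesianMonoidalCategory MonObj GrpObj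
open scoped CategoryTheory.Obj
open IsDedekindDomain IsDedekindDomain.HeightOneSpectrum
open scoped NumberField
open Literature Literature.AlgebraicGeometry.Motives Literature.NumberTheory.EllipticCurves
  Literature.AlgebraicGeometry.GroupSchemes Literature.RingTheory.DiscreteValuationRing

namespace Literature.NumberTheory.DiophantineGeometry

/-- **Koizumi's theorem at a finite place, modulo the Weil group chunk (W1) only** ([Koizumi1960, Thm. p. 377];
[BLRNeronModels1990, §1.2 Prop. 8 with §4.3 Prop. 6, §5.1 Thm. 5 and §6.5 Cor. 3]): given Weil's group-chunk theorem over
strictly henselian complete DVRs in the text `hW1` (universe `0`), for a number field `K`, an abelian variety `A / K`, a finite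
place `v` and an integral model `𝒳` of `A.X` over `𝓞_{K,(v)}` that is smooth of relative dimension `dim A` and proper, the total
space of `𝒳` is an abelian-scheme model of `A` at `v`.  Proof: `koizumi_reductionAt_of_roadW` ★ with (W0) :=
`exists_birationalGroupLaw_of_smooth_proper` ★ (the instance `IsOpenImmersion (Spec K → Spec R)` from `isOpenImmersion_specGenericPoint`).
[cite: Koizumi1960, Thm. p. 377] [cite: BLRNeronModels1990, §1.2 Prop. 8, §4.3 Prop. 6, §5.1 Thm. 5, §6.5 Cor. 3]
[cite: EdixhovenRomagny2012, Thm. 6.3] -/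
theorem koizumi_reductionAt_of_weilChunk
    (hW1 : ∀ (R : Type) [CommRing R] [IsDomain R] [IsDiscreteValuationRing R] [HenselianLocalRing R]
      [IsAdicComplete (IsLocalRing.maximalIdeal R) R],
      IsAlgClosed (IsLocalRing.ResidueField R) →
      ∀ (𝒳 : Over (Spec (.of R))) [Smooth 𝒳.hom] [IsSeparated 𝒳.hom] [QuasiCompact 𝒳.hom]
        [GeometricallyIrreducible 𝒳.hom],
        ∀ L : BirationalGroupLaw 𝒳, L.IsStrict →
          ∃ (G : Over (Spec (.of R))) (_ : GrpObj G) (j : 𝒳 ⟶ G),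
            Smooth G.hom ∧ IsSeparated G.hom ∧ QuasiCompact G.hom ∧ IsGroupChunkSolution L G j)
    {K : Type} [Field K] [NumberField K] (A : AbelianVariety K) (v : HeightOneSpectrum (𝓞 K))
    (𝒳 : IntegralModel (valuationSubringAtPrime K v) K A.X) (h𝒳 : 𝒳.IsSmoothProper A.dim) :
    ∃ _ : GrpObj 𝒳.total, IsAbelianSchemeModel A v 𝒳.total :=
  koizumi_reductionAt_of_roadW
    (fun R _ _ _ K _ _ _ 𝒳 _ _ _ E _ e => by
      haveI : IsOpenImmersion (specGenericPoint R K) := isOpenImmersion_specGenericPoint R K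
      exact SmoothProperModelBirationalGroupLaw.exists_birationalGroupLaw_of_smooth_proper R K 𝒳 E e)
    hW1 A v 𝒳 h𝒳

end Literature.NumberTheory.DiophantineGeometry

end
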